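import Literature.Computability.AlgebraicComplexity.HwvIdealRankBound
import HarnessLib

/-!
# Landsberg–Manivel–Ressayre: an explicit module of equations for the orbit closure of `det_3`
# in degree 12 (a cited fact), and its use on the determinant side of a multiplicity comparison

Topic `Computability/AlgebraicComplexity` (geometric complexity theory). Cell `pub-gct` (bundle
papers/PneNP/gct-obstructions; honest framing: rung-1 multiplicity-obstruction search for permanent
versus determinant at small `(n, m)`, no claim about VP ≠ VNP or P ≠ NP).

**Source.** J. M. Landsberg, L. Manivel, N. Ressayre, *Hypersurfaces with degenerate duals and the
geometric complexity theory program*, Comment. Math. Helv. **88** (2013) 469–484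
(DOI 10.4171/CMH/292; = arXiv:1004.4802). Theorem 1.1.2 (p. 470): "Consider the ideal of regular
functions on `S^n(M_n(ℂ))^*` that are zero on `\overline{GL_{n²}·[det_n]}`. We construct an explicit
sub-`GL_{n²}`-module `V_n` in this ideal which has the following properties. (1) The
`GL_{n²}`-module `V_n` contains an irreducible module of highest weight
`2n(n−1)(n−2)ω_1 + (2n²−4n−1)ω_2 + 2ω_{2n+1}` [and `V_n` lies in degree `2n(n−1)`, §3.1–3.2].
(2) The variety `\overline{GL_{n²}·[det_n]}` is an irreducible component of the zero locus of
`V_n`." (proved in §§2–3, Thm. 2.3.1 and Thm. 3.1.1), and §3.2 (p. 476): "A copy of the module with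
highest weight `2n(n−1)(n−2)ω_1 + (2n²−4n−1)ω_2 + 2ω_{2n+1}` in `S^{2n(n−1)}(S^nℂ^{n²})` is in the
ideal of `\overline{GL(W)·[det_n]}`. … For example, when `n = 3`, the module with highest weight
`12ω_1 + 5ω_2 + 2ω_7` occurs with multiplicity six in `S^{12}(S^3ℂ^9)`, but only one copy of it is
in the ideal."

**What is vendored.** Only the `n = 3` instance of part (1) — the existence of ONE nonzero
highest-weight vector of `GL_9`-type `λ = (19,7,2,2,2,2,2) ⊢ 36` (the partition with
`λ_i − λ_{i+1} = (12, 5, 0, 0, 0, 0, 2, 0)`, i.e. highest weight `12ω_1 + 5ω_2 + 2ω_7`) among the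
degree-12 polynomial functions on cubic forms in 9 variables that vanishes on `GL_9 · det_3` — as a
named fact `LMR2013_detThree_idealHwv` in the tree's vocabulary: `coordRep (MatIdx 3) ℂ 3`
(`OrbitCoordinateRing.lean`: the contragredient action on `ℂ[Sym³(ℂ^9)] = ⊕_d Sym^d(Sym³ℂ^9)^*`,
whose irreducible types are the DUAL weights `λ^*`, `exists_eq_dualOfPartition_of_hasHighestWeight_coordRep`),
upper-triangular Borel for the lexicographic order on `MatIdx 3`, weight
`(Weight.dualOfPartition 9 λ).toMatIdx` (the convention of `PerDetMultiplicityObstructionAt` and of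
`orbitMultiplicity_det_le_symKroneckerCoeffRect`), ideal `orbitVanishingIdeal (detFormLex ℂ 3) 3`.
Dictionary with the source: LMR write hypersurfaces as points of `S^n W^*` (`W = ℂ^{n²}`), so their
equations live in `S^e(S^n W)` with POLYNOMIAL types `S_π W`; the tree's form space carries the
transposed-inverse action, under which the same function `F` is a highest-weight vector of the dual
weight `π^*` for the same (upper) Borel up to the longest Weyl element; since the ideal of the orbit is
stable under the whole group, "a copy of `S_π W` lies in the ideal" (LMR) and "the ideal contains a
nonzero highest-weight vector of weight `π^*`" (tree) are the same assertion. The multiplicity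
statement "occurs with multiplicity six" is the plethysm coefficient `a_λ(12[3]) = 6`, NOT vendored
(it is an engine number of the cell, GATE-TABLES C9), and "only one copy" (exactness) is not needed
on the smaller side of a multiplicity comparison.
-- TODO(general form): Thm. 1.1.2 (1) for every `n ≥ 3`, with
-- `λ(n) = (2n³−4n²+1, 2n²−4n+1, 2^{2n−1}) ⊢ 2n²(n−1)` in degree `2n(n−1)` (cell letters `m = n`).

**What is proved here** (from the cited fact and `HwvIdealRankBound.lean`):
`orbitMultiplicity_detThree_lt_plethysmCoeff_of_LMR` (`mult_{λ^*} ℂ[Δ(det_3)] < a_λ`, i.e. `≤ 5`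
once `a_λ = 6` is known) and `perDetMultiplicityObstructionAt_detThree_of_LMR` (if the six — more
precisely `a_λ` many — highest-weight vectors of type `λ` are linearly independent on the orbit of
`per_3`, i.e. `a_λ ≤ r ≤ mult_{λ^*} ℂ[Δ(per_3)]`, then `(3, 3, 12, λ)` is a multiplicity obstruction;
no such evaluation is asserted here).

## References
* [LandsbergManivelRessayre2013] J. M. Landsberg, L. Manivel, N. Ressayre, Comment. Math. Helv. 88
  (2013) 469–484, Thm. 1.1.2 (p. 470), Thm. 2.3.1 (p. 474), Thm. 3.1.1 and §3.2 (p. 476).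
* [BurgisserIkenmeyer2013] P. Bürgisser, C. Ikenmeyer, STOC 2013 = arXiv:1210.8368, §5 (5.1)–(5.2)
  (ideal multiplicities versus `sk`).
-/

noncomputable section

open MvPolynomial

namespace Literature.Computability.AlgebraicComplexity

open _root_.Literature.NumberTheory.DiophantineGeometry

/-- The Landsberg–Manivel–Ressayre partition for `n = 3`: `λ = (19,7,2,2,2,2,2) ⊢ 36 = 3·12`, the
`GL_9`-type of highest weight `12ω_1 + 5ω_2 + 2ω_7` (`λ_1 − λ_2 = 12`, `λ_2 − λ_3 = 5`,
`λ_7 − λ_8 = 2`). [cite: LandsbergManivelRessayre2013, §3.2 (p. 476)] -/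
def lmrPartitionThree : Nat.Partition (3 * 12) :=
  Nat.Partition.ofSums _ (([19, 7, 2, 2, 2, 2, 2] : List ℕ) : Multiset ℕ) (by
    rw [Multiset.sum_coe]; rfl)

/-- The parts of `lmrPartitionThree` are `19, 7, 2, 2, 2, 2, 2`. [folklore] -/
theorem lmrPartitionThree_parts :
    lmrPartitionThree.parts = (([19, 7, 2, 2, 2, 2, 2] : List ℕ) : Multiset ℕ) := by
  change (([19, 7, 2, 2, 2, 2, 2] : List ℕ) : Multiset ℕ).filter (· ≠ 0) = _
  exact Multiset.filter_eq_self.2 fun x hx => by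
    simp only [Multiset.mem_coe, List.mem_cons, List.not_mem_nil, or_false] at hx
    omega

/-- `λ = (19,7,2^5)` has `7 ≤ 9 = 3²` parts (the side condition of
`PerDetMultiplicityObstructionAt`). [folklore] -/
theorem card_parts_lmrPartitionThree_le : lmrPartitionThree.parts.card ≤ 3 * 3 := by
  rw [lmrPartitionThree_parts, Multiset.coe_card]
  decide

/-- **Landsberg–Manivel–Ressayre 2013, Thm. 1.1.2 (1) with §3.2, the case `n = 3`** (cited fact):
the ideal of the orbit closure `Δ(det_3) = \overline{GL_9 · det_3} ⊆ Sym³(ℂ^9)` contains, in degree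
12, a copy of the irreducible `GL_9`-module of highest weight `12ω_1 + 5ω_2 + 2ω_7`, i.e. of type
`λ = (19,7,2,2,2,2,2)`; in the tree's vocabulary: some nonzero highest-weight vector of weight
`λ^*` (lexicographic upper Borel on `MatIdx 3`) of `coordRep (MatIdx 3) ℂ 3` lies in
`orbitVanishingIdeal (detFormLex ℂ 3) 3` (the weight pins the degree `12`). Journal text, p. 476:
"A copy of the module with highest weight `2n(n−1)(n−2)ω_1 + (2n²−4n−1)ω_2 + 2ω_{2n+1}` in
`S^{2n(n−1)}(S^nℂ^{n²})` is in the ideal of `\overline{GL(W)·[det_n]}`. … when `n = 3`, the module with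
highest weight `12ω_1 + 5ω_2 + 2ω_7` occurs with multiplicity six in `S^{12}(S^3ℂ^9)`, but only one copy
of it is in the ideal." (The module is LMR's `V_3`, the equations of hypersurfaces with dual variety
of dimension `≤ 4`, Thm. 2.3.1 with `k = 2n−2 = 4`, `d = n = 3`, `N = 9`, degree `(k+2)(d−1) = 12`.)
[cite: LandsbergManivelRessayre2013, Thm. 1.1.2 (1) (p. 470) and §3.2 (p. 476)] -/
def LMR2013_detThree_idealHwv : Prop :=
  ∃ F : MvPolynomial (DegIdx (MatIdx 3) 3) ℂ, F ≠ 0 ∧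
    F ∈ highestWeightSpace (coordRep (MatIdx 3) ℂ 3)
      (Weight.dualOfPartition (3 * 3) lmrPartitionThree).toMatIdx ∧
    F ∈ orbitVanishingIdeal (detFormLex ℂ 3) 3

/-- **Consequence on the determinant side**: granted the LMR fact, the multiplicity of type
`λ = (19,7,2^5)` in `ℂ[Δ(det_3)]_{12}` is strictly below the plethysm coefficient `a_λ(12[3])`
(so `≤ 5` once `a_λ = 6`); by `orbitMultiplicity_lt_plethysmCoeff_of_mem_orbitVanishingIdeal`.
[cite: LandsbergManivelRessayre2013, §3.2 (p. 476)] -/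
theorem orbitMultiplicity_detThree_lt_plethysmCoeff_of_LMR (h : LMR2013_detThree_idealHwv) :
    orbitMultiplicity ℂ (detFormLex ℂ 3) 3
        (Weight.dualOfPartition (3 * 3) lmrPartitionThree).toMatIdx <
      plethysmCoeff ℂ (MatIdx 3) 3 (Weight.dualOfPartition (3 * 3) lmrPartitionThree).toMatIdx := by
  obtain ⟨F, hF0, hF, hI⟩ := h
  exact orbitMultiplicity_lt_plethysmCoeff_of_mem_orbitVanishingIdeal (by norm_num) hF hI hF0

/-- **The `(3,3,12,(19,7,2^5))` certificate shape**: granted the LMR fact, if `a_λ(12[3]) ≤ r` and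
`r ≤ mult_{λ^*} ℂ[Δ(per_3)]` (an evaluation rank at points of `GL_9 · per_3`, e.g. via
`le_orbitMultiplicity_of_det_eval_ne_zero`; with `a_λ = 6` this means all six highest-weight vectors
of type `λ` stay independent on the orbit of the permanent — NOT asserted here), then `λ` is a
multiplicity obstruction for `det_3` versus `per_3` (`n = m = 3`, no padding: `X₀₀^0 · per_3`):
`mult_det < a_λ ≤ r ≤ mult_per`. (The separation `per_3 ∉ Δ(det_3)` itself is classical by
dimension count; the content is the representation-theoretic datum.) Via
`PerDetMultiplicityObstructionAt.of_idealHwv` with `s = 1`.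
[cite: LandsbergManivelRessayre2013, Thm. 1.1.2 (1) (p. 470)] -/
theorem perDetMultiplicityObstructionAt_detThree_of_LMR (h : LMR2013_detThree_idealHwv) {r : ℕ}
    (ha : plethysmCoeff ℂ (MatIdx 3) 3 (Weight.dualOfPartition (3 * 3) lmrPartitionThree).toMatIdx ≤ r)
    (hr : r ≤ orbitMultiplicity ℂ (paddedPerFormLex ℂ 3 3) 3
      (Weight.dualOfPartition (3 * 3) lmrPartitionThree).toMatIdx) :
    PerDetMultiplicityObstructionAt (k := ℂ) 3 3 12 lmrPartitionThree := by
  obtain ⟨F, hF0, hF, hI⟩ := h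
  refine PerDetMultiplicityObstructionAt.of_idealHwv (s := 1) (r := r) le_rfl
    card_parts_lmrPartitionThree_le (fun _ : Fin 1 => F) (fun _ => hF) (fun _ => hI)
    (linearIndependent_unique_iff.mpr hF0) (by omega) hr

/-- With the LMR fact and such an evaluation rank, `dc(per_3) > 3` follows formally (of course
`dc(per_3) = 7` is known, Alper–Bogart–Velasco; recorded only to show the chain closes).
[cite: LandsbergManivelRessayre2013, Thm. 1.1.2 (1) (p. 470)] -/
theorem three_lt_dc_perThree_of_LMR (h : LMR2013_detThree_idealHwv) {r : ℕ}
    (ha : plethysmCoeff ℂ (MatIdx 3) 3 (Weight.dualOfPartition (3 * 3) lmrPartitionThree).toMatIdx ≤ r)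
    (hr : r ≤ orbitMultiplicity ℂ (paddedPerFormLex ℂ 3 3) 3
      (Weight.dualOfPartition (3 * 3) lmrPartitionThree).toMatIdx) :
    3 < determinantalComplexity (perPoly (Fin 3) ℂ) :=
  lt_determinantalComplexity_perPoly_of_perDetMultiplicityObstructionAt
    (perDetMultiplicityObstructionAt_detThree_of_LMR h ha hr)

/-! ### With a det-side rank certificate: LMR's "only one copy" becomes an exact count -/

/-- **Exactly one copy in the ideal, exactly five on `Δ(det_3)`.** Granted the LMR fact (one
nonzero highest-weight vector of type `λ* = (19,7,2^5)^*` in `I(GL_9 · det_3)`, degree 12), a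
det-side rank certificate `r' ≤ mult_{λ*} ℂ[Δ(det_3)]` with `a_λ ≤ r' + 1` (the cell's det cell:
`r' = 5`, `a_λ = 6`) pins BOTH numbers of LMR13 §3.2 (p. 476: "occurs with multiplicity six in
`S^{12}(S^3ℂ^9)`, but only one copy of it is in the ideal"): `mult_{λ*} ℂ[Δ(det_3)] + 1 = a_λ` and the
weight-`λ*` highest-weight vectors in `I(GL_9 · det_3)` form a space of dimension exactly `1`
(rank–nullity `orbitMultiplicity_add_finrank_inf_eq_plethysmCoeff`). The printed "only one copy"
is thus CERTIFIED by the rank (upper bound on the ideal side) modulo the cited existence of one copy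
(lower bound). [cite: LandsbergManivelRessayre2013, §3.2 (p. 476)] -/
theorem finrank_hwv_inf_idealDetThree_eq_one_of_LMR_of_rank (h : LMR2013_detThree_idealHwv)
    {r' : ℕ}
    (ha : plethysmCoeff ℂ (MatIdx 3) 3 (Weight.dualOfPartition (3 * 3) lmrPartitionThree).toMatIdx ≤
      r' + 1)
    (hr' : r' ≤ orbitMultiplicity ℂ (detFormLex ℂ 3) 3
      (Weight.dualOfPartition (3 * 3) lmrPartitionThree).toMatIdx) :
    orbitMultiplicity ℂ (detFormLex ℂ 3) 3
          (Weight.dualOfPartition (3 * 3) lmrPartitionThree).toMatIdx + 1 =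
        plethysmCoeff ℂ (MatIdx 3) 3 (Weight.dualOfPartition (3 * 3) lmrPartitionThree).toMatIdx ∧
      Module.finrank ℂ ↥(highestWeightSpace (coordRep (MatIdx 3) ℂ 3)
            (Weight.dualOfPartition (3 * 3) lmrPartitionThree).toMatIdx ⊓
          (orbitVanishingIdeal (detFormLex ℂ 3) 3).restrictScalars ℂ) = 1 := by
  have hlt := orbitMultiplicity_detThree_lt_plethysmCoeff_of_LMR h
  have hrn := orbitMultiplicity_add_finrank_inf_eq_plethysmCoeff (k := ℂ) (detFormLex ℂ 3)
    (m := 3) (by norm_num)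
    ((Weight.dualOfPartition (3 * 3) lmrPartitionThree).toMatIdx : Weight (MatIdx 3))
  omega

/-- **The complete `(3,3,12,(19,7,2^5))` reading** (CHAIN′ row of the cell): granted the LMR fact,
a det-side rank `r'` with `a_λ ≤ r' + 1`, `r' ≤ mult_det`, and a permanent-side rank `r` with
`a_λ ≤ r ≤ mult_per` give `mult_{λ*} ℂ[Δ(det_3)] + 1 = a_λ ≤ mult_{λ*} ℂ[Δ(per_3)]`: a multiplicity
obstruction with gap at least one in which the determinant side is an EXACT printed-and-certified
value. (With BLMW §4.4's `mult_per ≤ a_λ`, tree `orbitMultiplicity_paddedPer_eq_plethysmCoeff_of_le`,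
the gap is exactly one.) [cite: LandsbergManivelRessayre2013, §3.2 (p. 476)] -/
theorem perDet_detThree_exact_of_LMR_of_ranks (h : LMR2013_detThree_idealHwv) {r r' : ℕ}
    (ha' : plethysmCoeff ℂ (MatIdx 3) 3 (Weight.dualOfPartition (3 * 3) lmrPartitionThree).toMatIdx ≤
      r' + 1)
    (hr' : r' ≤ orbitMultiplicity ℂ (detFormLex ℂ 3) 3
      (Weight.dualOfPartition (3 * 3) lmrPartitionThree).toMatIdx)
    (ha : plethysmCoeff ℂ (MatIdx 3) 3 (Weight.dualOfPartition (3 * 3) lmrPartitionThree).toMatIdx ≤ r)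
    (hr : r ≤ orbitMultiplicity ℂ (paddedPerFormLex ℂ 3 3) 3
      (Weight.dualOfPartition (3 * 3) lmrPartitionThree).toMatIdx) :
    orbitMultiplicity ℂ (detFormLex ℂ 3) 3
          (Weight.dualOfPartition (3 * 3) lmrPartitionThree).toMatIdx + 1 =
        plethysmCoeff ℂ (MatIdx 3) 3 (Weight.dualOfPartition (3 * 3) lmrPartitionThree).toMatIdx ∧
      plethysmCoeff ℂ (MatIdx 3) 3 (Weight.dualOfPartition (3 * 3) lmrPartitionThree).toMatIdx ≤
        orbitMultiplicity ℂ (paddedPerFormLex ℂ 3 3) 3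
          (Weight.dualOfPartition (3 * 3) lmrPartitionThree).toMatIdx ∧
      PerDetMultiplicityObstructionAt (k := ℂ) 3 3 12 lmrPartitionThree :=
  ⟨(finrank_hwv_inf_idealDetThree_eq_one_of_LMR_of_rank h ha' hr').1, ha.trans hr,
    perDetMultiplicityObstructionAt_detThree_of_LMR h ha hr⟩

end Literature.Computability.AlgebraicComplexity
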